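import Summits.NavierStokesRegularity.NavierStokesRegularity.Theorems.PalasekTowerBreakdownEpisodeBaseShadowedRun
set_option linter.dupNamespace false

/-! # Sketch — crux idea `weightdoor` (EpisodeBase, stmt-NavierStokesRegularity-19179): FIRST LEMMA
The weighted linearised enstrophy inequality under a QUADRATIC-FORM CERTIFICATE (Gallay–Wayne / Maekawa weighted
energy structure transplanted to the certificate road). Statements only; nothing here is registered. -/

noncomputable section

namespace Summit.NavierStokesRegularity.NavierStokesRegularity.Cruxes.EpisodeBase.WeightDoor

open Set MeasureTheory Metric
open scoped ContDiff Laplacian InnerProductSpace RealInnerProductSpace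
open Literature.Analysis Literature.Analysis.FluidPDE Literature.Analysis.FunctionSpaces

local notation "E3" => EuclideanSpace ℝ (Fin 3)

/-- Classical solutions of Navier–Stokes LINEARISED at a reference field `w` (unit viscosity), with source `g`:
`∂ₜf + (w·∇)f + (f·∇)w + ∇π = Δf + g`, `div f = 0`, `f, π` jointly smooth on `S × ℝ³`
(the fields of `IsClassicalNSSolutionOn`, momentum replaced by its linearisation). -/
structure IsClassicalLinearizedNSSolutionOn (S : Set ℝ) (w g f : ℝ → E3 → E3) (π : ℝ → E3 → ℝ) : Prop where
  smooth_velocity : IsSmoothSpaceTimeOn S f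
  smooth_pressure : IsSmoothSpaceTimeOn S π
  momentum : ∀ t ∈ S, ∀ x,
    timeDerivWithin S f t x + convect (w t) (f t) x + convect (f t) (w t) x = (Δ (f t)) x - gradient (π t) x + g t x
  divFree : ∀ t ∈ S, VectorCalculus.IsDivFree (f t)

/-- THE QUADRATIC-FORM CERTIFICATE of a design `w` on `[t₀, t₁]` for a (time-independent) weight `ρ` and a rate
`Λ`: for every smooth compactly supported divergence-free test velocity `f` with vorticity `ζ = curl f`, and
`Ω = curl w(t)`, the weighted enstrophy production form
`Q_t(f) = ∫ (w·∇ρ + Δρ)|ζ|² − 2ρ|∇ζ|² + 2ρ ⟪(∇w)ζ, ζ⟫ + 2ρ ⟪(Ω·∇)f − (f·∇)Ω, ζ⟫`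
is at most `2 Λ(t) ∫ ρ |ζ|²`. This is the top of the spectrum of a SELF-ADJOINT weighted form (the skew parts of
the linearisation are invisible to it) — a certifiable eigenvalue bound, not a semigroup bound. -/
def FormCertificate (t₀ t₁ : ℝ) (w : ℝ → E3 → E3) (ρ : E3 → ℝ) (Λ : ℝ → ℝ) : Prop :=
  ∀ t ∈ Icc t₀ t₁, ∀ f : E3 → E3, ContDiff ℝ ∞ f → HasCompactSupport f → VectorCalculus.IsDivFree f →
    (∫ x, ((fderiv ℝ ρ x (w t x) + (Δ ρ) x) * ‖curl f x‖ ^ 2 - 2 * ρ x * ‖fderiv ℝ (curl f) x‖ ^ 2 +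
        2 * ρ x * ⟪fderiv ℝ (w t) x (curl f x), curl f x⟫_ℝ +
        2 * ρ x * ⟪fderiv ℝ f x (curl (w t) x) - fderiv ℝ (curl (w t)) x (f x), curl f x⟫_ℝ)) ≤
      2 * Λ t * ∫ x, ρ x * ‖curl f x‖ ^ 2

/-- **FIRST LEMMA of the line (checkable, M-sized): weighted linearised enstrophy grows at most like `e^{2∫Λ}`.**
For a smooth divergence-free design `w` with bounded gradient and at most linear growth, a bounded `C²` weight
`ρ ≥ 1` of polynomial growth with its first and second derivatives, a continuous rate `Λ` carrying the form certificate, and any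
rapidly decaying classical solution `f` of the homogeneous linearised system on `[t₀, t₁]` (the weight may grow
polynomially — Gallay–Wayne's `L²(m)` spaces, where the strain–diffusion operator has a spectral gap up to `(m−1)/2`; the
Gaussian space is the `m → ∞` limit):
`∫ ρ |curl f(t)|² ≤ exp(2 ∫_{t₀}^{t} Λ) · ∫ ρ |curl f(t₀)|²`. (Energy identity for the linearised vorticity equation
`∂ₜζ + (w·∇)ζ − (ζ·∇)w + (f·∇)Ω − (Ω·∇)f = Δζ` against `ρ ζ`, density of test fields, Grönwall.) -/
def FirstLemma : Prop :=
  ∀ (t₀ t₁ : ℝ) (w f : ℝ → E3 → E3) (π : ℝ → E3 → ℝ) (ρ : E3 → ℝ) (Λ : ℝ → ℝ),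
    t₀ < t₁ →
    IsSmoothSpaceTimeOn (Icc t₀ t₁) w → (∀ t ∈ Icc t₀ t₁, VectorCalculus.IsDivFree (w t)) →
    (∃ C : ℝ, ∀ t ∈ Icc t₀ t₁, ∀ x, ‖w t x‖ ≤ C * (1 + ‖x‖) ∧ ‖fderiv ℝ (w t) x‖ ≤ C ∧
        ‖iteratedFDeriv ℝ 2 (w t) x‖ ≤ C) →
    IsClassicalLinearizedNSSolutionOn (Icc t₀ t₁) w 0 f π → HasUniformRapidDecayOn (Icc t₀ t₁) f →
    ContDiff ℝ 2 ρ → (∀ x, 1 ≤ ρ x) →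
    (∃ (C : ℝ) (m : ℕ), ∀ x, ρ x ≤ C * (1 + ‖x‖) ^ m ∧ ‖fderiv ℝ ρ x‖ ≤ C * (1 + ‖x‖) ^ m ∧
        |(Δ ρ) x| ≤ C * (1 + ‖x‖) ^ m) →
    ContinuousOn Λ (Icc t₀ t₁) → FormCertificate t₀ t₁ w ρ Λ →
    ∀ t ∈ Icc t₀ t₁,
      ∫ x, ρ x * ‖curl (f t) x‖ ^ 2 ≤ Real.exp (2 * ∫ s in t₀..t, Λ s) * ∫ x, ρ x * ‖curl (f t₀) x‖ ^ 2

end Summit.NavierStokesRegularity.NavierStokesRegularity.Cruxes.EpisodeBase.WeightDoor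

end
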